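import Literature.Computability.AlgebraicComplexity.PartialMatrixMultiplicationRestriction
import Literature.Computability.AlgebraicComplexity.BorderRankRestriction
import Literature.Computability.AlgebraicComplexity.SchoenhageTauDischarge
import Literature.Computability.AlgebraicComplexity.FlatteningBound
import HarnessLib

/-!
# Schönhage's partial matrix multiplication theorem — proof (BCS 1997, Thm. (15.48))

Topic `Literature/Computability/AlgebraicComplexity`. DISCHARGE of the named fact
`Schonhage1981_partialMatMul` (`PartialMatrixMultiplication.lean`): over an infinite field,
`bR(⟨e, h, l⟩_{I,J}) ≤ r ⇒ f^{ω/3} ≤ r`, `f = #{(i,j,k) : (i,j) ∈ I, (j,k) ∈ J}`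
(Bürgisser–Clausen–Shokrollahi 1997, Thm. (15.48); Schönhage 1981, Thm. 4.1). The proof is the
printed one (BCS pp. 409–410), on top of `PartialMatrixMultiplicationRestriction.lean`
((15.46) and Lemma (15.47) in coordinates):

1. `bR((⟨e,h,l⟩_{I,J})^{⊗N}) ≤ r^N` (`algBorderRank_kroneckerPow_le`), and the power is the partial
   matrix multiplication of pattern `(I^N, J^N)` (`kroneckerPow_partialMatMulTensor_zip`).
2. For a distribution (type) `σ` of middle words `w ∈ [h]^N`, the column count
   `m_w = ∏_s m_{w_s} = M` and row count `p_w = P` are constant on the type class `ν^σ`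
   (`prod_eq_of_card_filter_eq`), so by Lemma (15.47) the total `⟨M, |ν^σ|, P⟩` is a restriction
   of the power, `bR(⟨M, |ν^σ|, P⟩) ≤ r^N` (`TensorRestrictsTo.algBorderRank_le`), and Bini's
   theorem (BCS Prop. (15.10) = Bläser 2013, Thm. 6.6, `Blaser2013_thm66_holds`) gives
   `(M P |ν^σ|)^{ω/3} ≤ r^N` — (15.49).
3. `f^N = ∑_w m_w p_w = ∑_σ M_σ P_σ |ν^σ|` (`filling_eq_sum_card_mul_card`,
   `sum_prod_mul_prod_eq_pow`); BCS sum (15.49) over the `binom(N+|ν|-1, |ν|-1)` distributions, we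
   equivalently bound `f^N ≤ (N+1)^h · max_σ M_σ P_σ |ν^σ|` by pigeonhole over the `≤ (N+1)^h`
   types (`exists_block_volume`), whence `(f^{ω/3})^N ≤ (N+1)^h r^N` for all `N`.
4. "Taking `N`-th roots and letting `N → ∞`": `le_of_forall_pow_le_polynomial_mul_pow`
   (`SchoenhageTauDischarge.lean`).

Side conditions made explicit: `f = 0` is trivial (`ω/3 > 0`, `omega_two_le`); for `f ≥ 1` the
tensor is nonzero, so `r ≥ bR ≥ 1` (`one_le_algBorderRank_of_ne_zero`), which Bini's theorem needs;
blocks of volume `≤ 1` are handled directly. "By Cor. (15.18) we may assume `k` infinite" is not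
needed: the fact is stated for infinite `K` (the section's standing hypothesis), and the
Vandermonde form of Lemma (15.47) uses only an injection of a finite index type into `K`.

## References

* [BurgisserClausenShokrollahi1997] P. Bürgisser, M. Clausen, M. A. Shokrollahi, *Algebraic
  Complexity Theory*, Springer 1997, §15.9, Thm. (15.48) and its proof, (15.49) (pp. 409–410;
  held, read), Prop. (15.10).
* [Schonhage1981] A. Schönhage, *Partial and total matrix multiplication*, SIAM J. Comput. 10
  (1981) 434–455, Thm. 4.1.
* [Blaser2013] M. Bläser, *Fast Matrix Multiplication*, Theory of Computing Graduate Surveys 5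
  (2013), Thm. 6.6 (Bini's theorem, as discharged in `SchoenhageTauBini.lean`).
-/

noncomputable section

open scoped BigOperators

namespace Literature.Computability.AlgebraicComplexity

/-! ## Border rank of a nonzero tensor -/

section Nonzero

variable {K : Type*} [CommSemiring K] {ι κ μ : Type*} [Fintype ι] [Fintype κ] [Fintype μ]
  [DecidableEq ι] [DecidableEq κ] [DecidableEq μ]

/-- A nonzero tensor has border rank at least `1`: an approximate decomposition with `0` triads
represents `ε^h · 0`. [folklore] -/
theorem one_le_algBorderRank_of_ne_zero {t : ι → κ → μ → K} (ht : t ≠ 0) :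
    1 ≤ algBorderRank t := by
  obtain ⟨h, hh⟩ := exists_algBorderRank_eq_approxRank t
  rw [hh]
  by_contra hlt
  have h0 : approxRank h t = 0 := by omega
  obtain ⟨u, v, w, huvw⟩ := exists_isApproxDecomposition_approxRank h t
  haveI : IsEmpty (Fin (approxRank h t)) := by
    rw [h0]
    infer_instance
  apply ht
  funext a b c
  have key := huvw a b c h le_rfl
  rw [if_pos rfl, Finset.univ_eq_empty, Finset.sum_empty, Polynomial.coeff_zero] at key
  simp only [Pi.zero_apply]
  exact key.symm

end Nonzero

/-! ## Counting -/

section Counting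

/-- The filling is `∑_j m_j p_j` (`m_j = #{i : (i,j) ∈ I}`, `p_j = #{k : (j,k) ∈ J}`).
[cite: BurgisserClausenShokrollahi1997, Thm. (15.48)] -/
theorem filling_eq_sum_card_mul_card (e h l : ℕ) (I : Finset (Fin e × Fin h))
    (J : Finset (Fin h × Fin l)) :
    filling e h l I J = ∑ j : Fin h, (Finset.univ.filter fun i : Fin e => (i, j) ∈ I).card *
      (Finset.univ.filter fun k : Fin l => (j, k) ∈ J).card := by
  unfold filling
  rw [Finset.card_filter, Fintype.sum_prod_type]
  simp_rw [Fintype.sum_prod_type]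
  rw [Finset.sum_comm]
  refine Finset.sum_congr rfl fun j _ => ?_
  rw [Finset.card_filter, Finset.card_filter, Finset.sum_mul_sum]
  refine Finset.sum_congr rfl fun i _ => Finset.sum_congr rfl fun k _ => ?_
  by_cases hi : (i, j) ∈ I <;> by_cases hk : (j, k) ∈ J <;> simp [hi, hk]

/-- `#{f : [N] → X | ∀ s, P_s (f s)} = ∏_s #{x | P_s x}` (a box). [folklore] -/
theorem card_filter_forall_eq_prod_card {N : ℕ} {X : Type*} [Fintype X] (P : Fin N → X → Prop)
    [∀ s, DecidablePred (P s)] :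
    (Finset.univ.filter fun f : Fin N → X => ∀ s, P s (f s)).card =
      ∏ s, (Finset.univ.filter fun x => P s x).card := by
  rw [← Fintype.card_piFinset]
  congr 1
  ext f
  simp [Fintype.mem_piFinset]

/-- `∑_{w ∈ [h]^N} (∏_s m_{w_s}) (∏_s p_{w_s}) = (∑_j m_j p_j)^N` (multinomial expansion, the
count `f^N = ∑_σ binom(N,σ) ∏_j (m_j p_j)^{σ_j}` of the proof of Thm. (15.48) before grouping by
type). [cite: BurgisserClausenShokrollahi1997, Thm. (15.48) (proof)] -/
theorem sum_prod_mul_prod_eq_pow {N h : ℕ} (m p : Fin h → ℕ) :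
    ∑ w : Fin N → Fin h, (∏ s, m (w s)) * ∏ s, p (w s) = (∑ j, m j * p j) ^ N := by
  have key := Fintype.prod_sum (fun (_ : Fin N) (j : Fin h) => m j * p j)
  simp only [Finset.prod_const, Finset.card_univ, Fintype.card_fin] at key
  rw [key]
  refine Finset.sum_congr rfl fun w _ => ?_
  rw [Finset.prod_mul_distrib]

end Counting

/-! ## Theorem (15.48) -/

section Assembly

variable (K : Type) [Field K] [Infinite K]

omit [Field K] in
/-- A finite type maps injectively into an infinite field. [folklore] -/
theorem exists_injective_to_infinite (X : Type*) [Fintype X] :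
    ∃ x : X → K, Function.Injective x :=
  ⟨fun a => Infinite.natEmbedding K (Fintype.equivFin X a : ℕ),
    (Infinite.natEmbedding K).injective.comp
      (Fin.val_injective.comp (Fintype.equivFin X).injective)⟩

/-- **The block of one type** (proof of BCS Thm. (15.48), one distribution `σ`): for every `N`
there is a block volume `V = M · |ν^σ| · P` with `f^N ≤ (N+1)^h · V` (the type class of largest
weight carries at least the average of `f^N = ∑_w m_w p_w` over the `≤ (N+1)^h` types) and
`V^{ω/3} ≤ r^N` (the total matrix multiplication `⟨M, |ν^σ|, P⟩` is a restriction of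
`(⟨e,h,l⟩_{I,J})^{⊗N}` by Lemma (15.47), so `bR ≤ r^N`, and Bini's theorem Prop. (15.10) applies).
[cite: BurgisserClausenShokrollahi1997, Thm. (15.48) (proof, (15.49))] -/
theorem exists_block_volume (e h l : ℕ) (I : Finset (Fin e × Fin h)) (J : Finset (Fin h × Fin l))
    {r : ℕ} (hr : 1 ≤ r) (hbR : algBorderRank (partialMatMulTensor K e h l I J) ≤ r) (N : ℕ) :
    ∃ V : ℕ, filling e h l I J ^ N ≤ (N + 1) ^ h * V ∧
      (V : ℝ) ^ (omega K / 3) ≤ (r : ℝ) ^ N := by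
  classical
  -- column / row counts of the pattern and the weights of middle words
  set m : Fin h → ℕ := fun j => (Finset.univ.filter fun i : Fin e => (i, j) ∈ I).card with hm
  set p : Fin h → ℕ := fun j => (Finset.univ.filter fun k : Fin l => (j, k) ∈ J).card with hp
  set g : (Fin N → Fin h) → ℕ := fun w => (∏ s, m (w s)) * ∏ s, p (w s) with hg
  have hsum : ∑ w, g w = filling e h l I J ^ N := by
    rw [filling_eq_sum_card_mul_card]
    exact sum_prod_mul_prod_eq_pow m p
  -- the type of a word, with values in the finite type `Fin h → Fin (N+1)`
  set typ : (Fin N → Fin h) → (Fin h → Fin (N + 1)) := fun w j =>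
    ⟨(Finset.univ.filter fun s => w s = j).card,
      Nat.lt_succ_of_le ((Finset.card_filter_le _ _).trans (by simp))⟩ with htyp
  -- a type class of maximal weight carries at least the average weight
  obtain ⟨σ₀, -, hmax⟩ := Finset.exists_max_image (Finset.univ : Finset (Fin h → Fin (N + 1)))
    (fun σ => ∑ w ∈ Finset.univ.filter (fun w => typ w = σ), g w) Finset.univ_nonempty
  set S : Finset (Fin N → Fin h) := Finset.univ.filter fun w => typ w = σ₀ with hS
  have hfib : ∑ w, g w = ∑ σ, ∑ w ∈ Finset.univ.filter (fun w => typ w = σ), g w :=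
    (Finset.sum_fiberwise Finset.univ typ g).symm
  have hbound : filling e h l I J ^ N ≤ (N + 1) ^ h * ∑ w ∈ S, g w := by
    calc filling e h l I J ^ N = ∑ σ, ∑ w ∈ Finset.univ.filter (fun w => typ w = σ), g w := by
          rw [← hsum]
          exact hfib
      _ ≤ ∑ σ : Fin h → Fin (N + 1), ∑ w ∈ S, g w :=
          Finset.sum_le_sum fun σ _ => hmax σ (Finset.mem_univ _)
      _ = (N + 1) ^ h * ∑ w ∈ S, g w := by
          rw [Finset.sum_const, smul_eq_mul, Finset.card_univ, Fintype.card_fun, Fintype.card_fin,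
            Fintype.card_fin]
  have hω0 : 0 < omega K / 3 := by
    have := omega_two_le K
    linarith
  rcases S.eq_empty_or_nonempty with hS0 | ⟨w₀, hw₀⟩
  · refine ⟨0, by simpa [hS0] using hbound, ?_⟩
    rw [Nat.cast_zero, Real.zero_rpow hω0.ne']
    positivity
  -- on `S` the block format is constant
  set M : ℕ := ∏ s, m (w₀ s) with hM
  set P : ℕ := ∏ s, p (w₀ s) with hP
  have htypeq : ∀ w ∈ S, ∀ j, (Finset.univ.filter fun s => w s = j).card =
      (Finset.univ.filter fun s => w₀ s = j).card := by
    intro w hw j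
    have hw' : typ w = typ w₀ := by
      rw [(Finset.mem_filter.1 hw).2, (Finset.mem_filter.1 hw₀).2]
    have := congrArg (fun f : Fin h → Fin (N + 1) => (f j : ℕ)) hw'
    simpa [htyp] using this
  have hMw : ∀ w ∈ S, ∏ s, m (w s) = M := fun w hw => prod_eq_of_card_filter_eq (htypeq w hw) m
  have hPw : ∀ w ∈ S, ∏ s, p (w s) = P := fun w hw => prod_eq_of_card_filter_eq (htypeq w hw) p
  have hSsum : ∑ w ∈ S, g w = S.card * (M * P) := by
    rw [Finset.sum_congr rfl fun w hw => show g w = M * P by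
      rw [hg]
      dsimp only
      rw [hMw w hw, hPw w hw]]
    rw [Finset.sum_const, smul_eq_mul]
  refine ⟨M * S.card * P, ?_, ?_⟩
  · calc filling e h l I J ^ N ≤ (N + 1) ^ h * ∑ w ∈ S, g w := hbound
      _ = (N + 1) ^ h * (M * S.card * P) := by
          rw [hSsum]
          ring
  -- `⟨M, |S|, P⟩` is a restriction of the `N`-th power (Lemma (15.47)), so `bR ≤ r^N`
  set t := partialMatMulTensor K e h l I J with ht
  set IN : Finset ((Fin N → Fin e) × (Fin N → Fin h)) :=
    Finset.univ.filter fun q => ∀ s, (q.1 s, q.2 s) ∈ I with hIN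
  set JN : Finset ((Fin N → Fin h) × (Fin N → Fin l)) :=
    Finset.univ.filter fun q => ∀ s, (q.1 s, q.2 s) ∈ J with hJN
  set T : (Fin N → Fin e) × (Fin N → Fin l) → (Fin N → Fin e) × (Fin N → Fin h) →
      (Fin N → Fin h) × (Fin N → Fin l) → K :=
    fun a b c => kroneckerPow t N (fun s => (a.1 s, a.2 s)) (fun s => (b.1 s, b.2 s))
      (fun s => (c.1 s, c.2 s)) with hT
  have h1 : TensorRestrictsTo (kroneckerPow t N) T :=
    tensorRestrictsTo_precomp (kroneckerPow t N)
      (fun a : (Fin N → Fin e) × (Fin N → Fin l) => fun s => (a.1 s, a.2 s))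
      (fun b : (Fin N → Fin e) × (Fin N → Fin h) => fun s => (b.1 s, b.2 s))
      (fun c : (Fin N → Fin h) × (Fin N → Fin l) => fun s => (c.1 s, c.2 s))
  obtain ⟨x, hx⟩ := exists_injective_to_infinite K (Fin N → Fin e)
  obtain ⟨y, hy⟩ := exists_injective_to_infinite K (Fin N → Fin l)
  have hMcard : ∀ w ∈ S, (Finset.univ.filter fun i : Fin N → Fin e => (i, w) ∈ IN).card = M := by
    intro w hw
    rw [← hMw w hw]
    have heq : (Finset.univ.filter fun i : Fin N → Fin e => (i, w) ∈ IN) =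
        Finset.univ.filter fun i : Fin N → Fin e => ∀ s, (i s, w s) ∈ I := by
      ext i
      simp [hIN]
    rw [heq]
    convert card_filter_forall_eq_prod_card (fun s (i : Fin e) => (i, w s) ∈ I) using 1
  have hPcard : ∀ w ∈ S, (Finset.univ.filter fun k : Fin N → Fin l => (w, k) ∈ JN).card = P := by
    intro w hw
    rw [← hPw w hw]
    have heq : (Finset.univ.filter fun k : Fin N → Fin l => (w, k) ∈ JN) =
        Finset.univ.filter fun k : Fin N → Fin l => ∀ s, (w s, k s) ∈ J := by
      ext k
      simp [hJN]
    rw [heq]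
    convert card_filter_forall_eq_prod_card (fun s (k : Fin l) => (w s, k) ∈ J) using 1
  have h2 : TensorRestrictsTo T (matMulTensor K M S.card P) :=
    tensorRestrictsTo_matMulTensor_of_pattern x hx y hy IN JN T
      (fun a b c => kroneckerPow_partialMatMulTensor_zip K e h l I J N a b c) S hMcard hPcard
  have hbRN : algBorderRank (matMulTensor K M S.card P) ≤ r ^ N :=
    (h1.trans h2).algBorderRank_le.trans
      ((algBorderRank_kroneckerPow_le t N).trans (Nat.pow_le_pow_left hbR N))
  -- Bini's theorem
  rcases Nat.lt_or_ge (M * S.card * P) 2 with hV | hV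
  · have h01 : M * S.card * P = 0 ∨ M * S.card * P = 1 := by omega
    rcases h01 with h0 | h1'
    · rw [h0, Nat.cast_zero, Real.zero_rpow hω0.ne']
      positivity
    · rw [h1', Nat.cast_one, Real.one_rpow]
      exact_mod_cast Nat.one_le_pow N r hr
  · have hb := Blaser2013_thm66_holds K M S.card P (r ^ N) hV (Nat.one_le_pow _ _ hr) hbRN
    have hq0 : (0 : ℝ) < ((M * S.card * P : ℕ) : ℝ) := by
      exact_mod_cast (by omega : 0 < M * S.card * P)
    have hq1 : (1 : ℝ) < ((M * S.card * P : ℕ) : ℝ) := by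
      exact_mod_cast (by omega : 1 < M * S.card * P)
    have hR0 : (0 : ℝ) < ((r ^ N : ℕ) : ℝ) := by
      exact_mod_cast Nat.one_le_pow N r hr
    have hω : omega K / 3 ≤ Real.logb ((M * S.card * P : ℕ) : ℝ) ((r ^ N : ℕ) : ℝ) := by
      linarith
    calc ((M * S.card * P : ℕ) : ℝ) ^ (omega K / 3)
        ≤ ((M * S.card * P : ℕ) : ℝ) ^ Real.logb ((M * S.card * P : ℕ) : ℝ) ((r ^ N : ℕ) : ℝ) :=
          Real.rpow_le_rpow_of_exponent_le hq1.le hω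
      _ = ((r ^ N : ℕ) : ℝ) := Real.rpow_logb hq0 hq1.ne' hR0
      _ = (r : ℝ) ^ N := by push_cast; ring

/-- DISCHARGE of `Schonhage1981_partialMatMul` — **Schönhage's partial matrix multiplication
theorem** (BCS 1997, Thm. (15.48); Schönhage 1981, Thm. 4.1), proof as printed (BCS pp. 409–410):
`f = 0` is trivial and otherwise `r ≥ bR ≥ 1`; for every `N`, `exists_block_volume` gives
`f^N ≤ (N+1)^h V` and `V^{ω/3} ≤ r^N`, hence `(f^{ω/3})^N ≤ (N+1)^h r^N` (using `ω ≤ 3`), and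
"taking `N`-th roots and letting `N → ∞`" (`le_of_forall_pow_le_polynomial_mul_pow`) gives
`f^{ω/3} ≤ r`. [cite: BurgisserClausenShokrollahi1997, Thm. (15.48) (p. 409)] -/
theorem Schonhage1981_partialMatMul_holds : Schonhage1981_partialMatMul := by
  intro K _ _ e h l I J r hbR
  classical
  have hω0 : 0 < omega K / 3 := by
    have := omega_two_le K
    linarith
  have hω1 : omega K / 3 ≤ 1 := by
    have := omega_le_three' K
    linarith
  rcases Nat.eq_zero_or_pos (filling e h l I J) with hf0 | hfpos
  · rw [hf0, Nat.cast_zero, Real.zero_rpow hω0.ne']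
    positivity
  -- `f ≥ 1`: the tensor is nonzero, so `r ≥ 1`
  have hr : 1 ≤ r := by
    obtain ⟨q, hq⟩ := Finset.card_pos.1 hfpos
    rw [Finset.mem_filter] at hq
    have hne : partialMatMulTensor K e h l I J ≠ 0 := by
      intro h0
      have := congrFun (congrFun (congrFun h0 (q.1, q.2.2)) (q.1, q.2.1)) (q.2.1, q.2.2)
      rw [partialMatMulTensor_apply, if_pos ⟨hq.2, rfl, rfl, rfl⟩] at this
      exact one_ne_zero this
    exact (one_le_algBorderRank_of_ne_zero hne).trans hbR
  have hf0 : (0 : ℝ) ≤ filling e h l I J := Nat.cast_nonneg _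
  refine le_of_forall_pow_le_polynomial_mul_pow _ _ 1 h (Nat.cast_nonneg _) fun N => ?_
  obtain ⟨V, hVle, hVr⟩ := exists_block_volume K e h l I J hr hbR N
  have hN1 : (1 : ℝ) ≤ ((N : ℝ) + 1) ^ h := one_le_pow₀ (by linarith [N.cast_nonneg (α := ℝ)])
  calc ((filling e h l I J : ℝ) ^ (omega K / 3)) ^ N
      = (((filling e h l I J ^ N : ℕ)) : ℝ) ^ (omega K / 3) := by
        rw [← Real.rpow_natCast, ← Real.rpow_mul hf0, mul_comm, Real.rpow_mul hf0,
          Real.rpow_natCast, Nat.cast_pow]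
    _ ≤ ((((N + 1) ^ h * V : ℕ)) : ℝ) ^ (omega K / 3) :=
        Real.rpow_le_rpow (Nat.cast_nonneg _) (by exact_mod_cast hVle) hω0.le
    _ = (((N : ℝ) + 1) ^ h) ^ (omega K / 3) * (V : ℝ) ^ (omega K / 3) := by
        push_cast
        exact Real.mul_rpow (by positivity) (Nat.cast_nonneg _)
    _ ≤ ((N : ℝ) + 1) ^ h * (r : ℝ) ^ N := by
        refine mul_le_mul ?_ hVr (Real.rpow_nonneg (Nat.cast_nonneg _) _) (by positivity)
        calc (((N : ℝ) + 1) ^ h) ^ (omega K / 3) ≤ (((N : ℝ) + 1) ^ h) ^ (1 : ℝ) :=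
              Real.rpow_le_rpow_of_exponent_le hN1 hω1
          _ = ((N : ℝ) + 1) ^ h := Real.rpow_one _
    _ = 1 * ((N : ℝ) + 1) ^ h * (r : ℝ) ^ N := by ring

end Assembly

end Literature.Computability.AlgebraicComplexity

end
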